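import Mathlib
import HarnessLib
import Summits.AtomisticToContinuum.FouriersLaw.Theses.JunctionLocality
import Summits.AtomisticToContinuum.FouriersLaw.Theorems.JunctionLocalityConductanceLowerBoundAbelFloorFrequently

/-!
# Strategist r1 — typed route-level decomposition of `JunctionLocality.ConductanceLowerBound`

`ConductanceLowerBound ⟸ OpenChainAbelFloorFrequently ∧ SignedSlowRegularity`
(bulk half (A⁻⁻) + contact half (R⁻)); the implication is the LANDED theorem
`AbelFloorExchange.conductanceLowerBound_of_abelFloorFrequently_and_signedSlowRegularity` (p161612),
whose conclusion is the `StaticAbelianSqueeze` copy of the crux (definitionally equal).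
The two `def`s below are spelled exactly as they will be filed as route items (fully qualified).
-/

open scoped BigOperators Topology Manifold Classical MeasureTheory ProbabilityTheory Matrix InnerProductSpace ComplexConjugate ContinuousMap
open Filter Set Function TopologicalSpace MeasureTheory

namespace Summit.AtomisticToContinuum.FouriersLaw.Cruxes.ConductanceLowerBound.StrategistR1

/-- (A⁻⁻) bulk half: an `N`-linear Abel floor of the equilibrium open-chain current autocorrelation at SOME
Laplace frequency below every threshold. -/
def OpenChainAbelFloorFrequently : Prop :=
  ∀ ω₂ lam β γ : ℝ, 0 < ω₂ → 0 < lam → 0 < β → 0 < γ → ∀ T : ℝ, 0 < T → ∃ a : ℝ, 0 < a ∧ ∀ ν₁ : ℝ, 0 < ν₁ → ∃ ν : ℝ, 0 < ν ∧ ν < ν₁ ∧ ∃ N₀ : ℕ, ∀ N : ℕ, N₀ ≤ N → a * N ≤ ∫ t in Set.Ioi (0:ℝ), Real.exp (-(ν * t)) * ∫ z, (∑ i : Fin N, (Literature.MathematicalPhysics.KineticTheory.HeatConduction.pinnedChain ω₂ lam β γ).bondCurrent N i z) * (∫ y, (∑ i : Fin N, (Literature.MathematicalPhysics.KineticTheory.HeatConduction.pinnedChain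 ω₂ lam β γ).bondCurrent N i y) ∂((Literature.MathematicalPhysics.KineticTheory.HeatConduction.pinnedChain ω₂ lam β γ).transitionKernel N T T t.toNNReal z)) ∂((Literature.MathematicalPhysics.KineticTheory.HeatConduction.pinnedChain ω₂ lam β γ).gibbsMeasure N T)

/-- (R⁻) contact half: the `(1 - e^{-νt})`-weighted (slow) part of the Kubo integral is not more negative than `-εN`
for all small `ν` and large `N` ("the DC open-chain conductance is at least the small-frequency one, up to εN"). -/
def SignedSlowRegularity : Prop :=
  ∀ ω₂ lam β γ : ℝ, 0 < ω₂ → 0 < lam → 0 < β → 0 < γ → ∀ T : ℝ, 0 < T → ∀ ε : ℝ, 0 < ε → ∃ ν₀ : ℝ, 0 < ν₀ ∧ ∀ ν : ℝ, 0 < ν → ν < ν₀ → ∃ N₀ : ℕ, ∀ N : ℕ, N₀ ≤ N → -(ε * N) ≤ ∫ t in Set.Ioi (0:ℝ), (1 - Real.exp (-(ν * t))) * ∫ z, (∑ i : Fin N, (Literature.MathematicalPhysics.KineticTheory.HeatConduction.pinnedChain ω₂ lam β γ).bondCurrent N i z) * (∫ y, (∑ i : Fin N, (Literature.MathematicalPhysics.KineticTheory.HeatConduction.pinnedChain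 ω₂ lam β γ).bondCurrent N i y) ∂((Literature.MathematicalPhysics.KineticTheory.HeatConduction.pinnedChain ω₂ lam β γ).transitionKernel N T T t.toNNReal z)) ∂((Literature.MathematicalPhysics.KineticTheory.HeatConduction.pinnedChain ω₂ lam β γ).gibbsMeasure N T)

/-- The route-level glue, concluding the JunctionLocality crux BY NAME, by the landed p161612 theorem (term-mode, defeq of the
route copies). -/
theorem conductanceLowerBound_of_subs :
    OpenChainAbelFloorFrequently → SignedSlowRegularity →
      Summit.AtomisticToContinuum.FouriersLaw.Theses.JunctionLocality.ConductanceLowerBound :=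
  Summit.AtomisticToContinuum.FouriersLaw.Cruxes.ConductanceLowerBound.AbelFloorExchange.conductanceLowerBound_of_abelFloorFrequently_and_signedSlowRegularity

/-- Same, in the exact shape the gate renders for `--glue-by` (explicit lambda). -/
theorem conductanceLowerBound_of_subs' :
    OpenChainAbelFloorFrequently → SignedSlowRegularity →
      Summit.AtomisticToContinuum.FouriersLaw.Theses.JunctionLocality.ConductanceLowerBound :=
  fun hA hR => Summit.AtomisticToContinuum.FouriersLaw.Cruxes.ConductanceLowerBound.AbelFloorExchange.conductanceLowerBound_of_abelFloorFrequently_and_signedSlowRegularity hA hR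

#print axioms conductanceLowerBound_of_subs

end Summit.AtomisticToContinuum.FouriersLaw.Cruxes.ConductanceLowerBound.StrategistR1
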